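import Literature.AlgebraicGeometry.Modules.KernelFiniteLocallyFree
import Literature.AlgebraicGeometry.Motives.HodgeSheavesProofs
import Literature.AlgebraicGeometry.Motives.CotangentSheafAffineLocalizing
import Literature.AlgebraicGeometry.Motives.AbelianVarietyProofs
import Literature.AlgebraicGeometry.Motives.AbelianVarietyMulN
import HarnessLib

/-!
# The fibre of the cotangent sheaf of an abelian variety at the origin is free of rank `dim A`:
# `e^*Ω¹_{A/K} ≅ 𝒪_{Spec K}^{dim A}` and `π^* e^* Ω¹_{A/K} ≅ 𝒪_A^{dim A}`

Let `A` be an abelian variety over a field `K` (the tree's `Motives.AbelianVariety K`), with unit section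
`e = unitPt A : Spec K → A` and structure morphism `π = A.X.hom : A → Spec K`. This file proves the
«point half» of the freeness of `Ω¹_{A/K}` along Bosch–Lütkebohmert–Raynaud, *Néron Models*, §4.2
Prop. 2 (`Ω¹_{G/S} ≅ π^* e^* Ω¹_{G/S}` for a group scheme, so that `Ω¹` is free as soon as `e^*Ω¹`
is): for an abelian variety,

* `AbelianVariety.nonempty_pullback_unitPt_cotangentSheaf_iso_free` —
  **`e^*Ω¹_{A/K} ≅ 𝒪_{Spec K}^{Fin (dim A)}`** (universe `0`, the currency of the named fact
  `Mumford1970_cotangentSheaf_abelianVariety_free`), with the universe-polymorphic form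
  `…_of_card (ι) (hι : card ι = dim A) : e^*Ω¹ ≅ 𝒪^ι`;
* `AbelianVariety.nonempty_pullback_hom_pullback_unitPt_cotangentSheaf_iso_free` —
  **`π^* e^* Ω¹_{A/K} ≅ 𝒪_A^{Fin (dim A)}`** (+ `…_of_card`), the form consumed by the BLR assembly
  (`Ω¹_A ≅ π^*e^*Ω¹_A ≅ 𝒪_A^{dim A}`).

PROOF (all steps are tree theorems; no named fact). `A → Spec K` is smooth of relative dimension
`dim A` (`AbelianVariety.smoothOfRelativeDimension_dim`, Stacks 047N / Mumford §4 (ii)), so the origin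
has an affine neighbourhood `V` on which `Γ(V, Ω¹)` is free of rank `dim A` (Stacks 02G1 / 00T7,
tree `exists_basis_sections_cotangentSheaf`); since `Ω¹` is affine-localizing
(`isAffineLocalizing_cotangentSheaf`, Hartshorne II Rem. 8.9.2) this basis is a frame
`𝒪^ι ≅ Ω¹.over V` (tree `nonempty_free_iso_over_of_basis`); frames pull back
(`𝒪^ι ≅ (e^*Ω¹).over (e⁻¹V)`, Hartshorne II.5 p. 110, tree `KTheory/PullbackVectorBundle`), and
`e⁻¹V = Spec K` is everything, so `e^*Ω¹ ≅ 𝒪^ι` (`nonempty_iso_free_of_overIso_of_eq_top`, a frame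
over the whole space is a global trivialisation); finally `π^*𝒪^ι ≅ 𝒪^ι`.

Also: `nonempty_iso_free_of_overIso_of_eq_top` (any scheme: a trivialisation over an open equal to
`⊤` is a global one) and `AbelianVariety.unitPt_preimage_eq_top` (`e⁻¹V = ⊤` for `V ∋ origin`).

Everything is proved; no definitions, no named facts. Cell `pub-hodge-ring2`, route №4, crux
stmt-HodgeConjecture-26512, stub `stub_cotangentSheafFree` (BLR-absolute route, point half (iv)(v)).

presearch: «e^*Ω¹_{G/S} free / Ω¹_G ≅ π^*e^*Ω¹_G» → [cite: BoschLutkebohmertRaynaud1990 §4.2 Prop. 2]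
(locator from `Motives/AbelianVarietyCotangentSheafFree` docstring), [GortzWedhorn2023 Prop. 27.15]
(bus l.5727 page-read); tree: rg `pullback.*unitPt.*cotangentSheaf` → 0 hits; Mathlib: no scheme-level
`Ω_{X/S}` API for this; corpus+galaxy: not re-queried (textbook step, locators already held).

## References

* S. Bosch, W. Lütkebohmert, M. Raynaud, *Néron Models* (1990), §4.2 Prop. 2. [BoschLutkebohmertRaynaud1990]
* The Stacks project, Tags 02G1, 047N. [StacksProject]
* R. Hartshorne, *Algebraic Geometry* (1977), II §5 p. 110 (pull-back of locally free sheaves),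
  II Rem. 8.9.2. [Hartshorne1977]
-/

noncomputable section

open CategoryTheory AlgebraicGeometry TopologicalSpace Opposite

universe u

namespace Literature.AlgebraicGeometry.Motives

open Literature.AlgebraicGeometry.Modules Literature.AlgebraicGeometry.KTheory

/-! ### A trivialisation over an open equal to the whole space is a global trivialisation -/

section OverTop

-- `TopCat.Presheaf`/`Scheme.Modules` are not reducible (as in Mathlib's `AlgebraicGeometry/Modules`).
set_option backward.isDefEq.respectTransparency false

/-- **A frame over an open `W = X` is a global trivialisation**: from `𝒪^ι ≅ N.over W` with `W = ⊤`
to `N ≅ 𝒪^ι` (restrict along `⊤ ↪ X`, an isomorphism of schemes `X.topIso`, pull back along its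
inverse, and use `f^*𝒪^ι ≅ 𝒪^ι`). [cite: Hartshorne1977, II §5 (p. 110)] -/
theorem nonempty_iso_free_of_overIso_of_eq_top {S : Scheme.{u}} (N : S.Modules) {W : S.Opens}
    (hW : W = ⊤) {ι : Type u} (e : SheafOfModules.free ι ≅ N.over W) :
    Nonempty (N ≅ SheafOfModules.free ι) := by
  subst hW
  obtain ⟨e₁⟩ := nonempty_restrictIso_of_overIso e
  -- `𝒪^ι ≅ (⊤ ↪ S)^* N` on the open subscheme `⊤`
  let e₂ : SheafOfModules.free ι ≅ (Scheme.Modules.pullback (⊤ : S.Opens).ι).obj N :=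
    e₁ ≪≫ (Scheme.Modules.restrictFunctorIsoPullback (⊤ : S.Opens).ι).app N
  -- pull back along the inverse isomorphism `S ≅ ⊤`
  let F := Scheme.Modules.pullback S.topIso.inv
  obtain ⟨e₃⟩ := nonempty_pullbackFreeIso S.topIso.inv ι
  let e₄ : F.obj ((Scheme.Modules.pullback (⊤ : S.Opens).ι).obj N) ≅ N :=
    (Scheme.Modules.pullbackComp S.topIso.inv (⊤ : S.Opens).ι).app N ≪≫
      (Scheme.Modules.pullbackCongr (Scheme.toIso_inv_ι S)).app N ≪≫
        (Scheme.Modules.pullbackId (X := S)).app N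
  exact ⟨e₄.symm ≪≫ (F.mapIso e₂).symm ≪≫ e₃⟩

end OverTop

/-! ### The fibre of `Ω¹_{A/K}` at the origin -/

namespace AbelianVariety

variable {K : Type u} [Field K] (A : AbelianVariety K)

/-- The unit section `e : Spec K → A` lands in every open containing the origin: `e⁻¹V = Spec K` (the image of
the `K`-rational point `e` is the single point `origin A`; Görtz–Wedhorn I Prop. 3.33). [cite: GortzWedhorn2020, Prop. 3.33] -/
theorem unitPt_preimage_eq_top {V : A.X.left.Opens} (he : origin A ∈ V) : (unitPt A) ⁻¹ᵁ V = ⊤ :=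
  top_le_iff.mp fun x _ => by
    change (unitPt A).base x ∈ V
    rw [eq_specPt K x]
    exact he

-- `TopCat.Presheaf`/`Scheme.Modules` are not reducible (as in Mathlib's `AlgebraicGeometry/Modules`).
set_option backward.isDefEq.respectTransparency false in
/-- **`e^*Ω¹_{A/K} ≅ 𝒪_{Spec K}^ι` for any index type with `dim A` elements** (universe-polymorphic
form): `A/K` is smooth of relative dimension `dim A`, so `Ω¹` has a frame of size `dim A` on an affine
neighbourhood of the origin, which pulls back along `e` to a global frame of `e^*Ω¹`.
[cite: BoschLutkebohmertRaynaud1990, §4.2 Prop. 2] [cite: StacksProject, Tag 02G1] -/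
theorem nonempty_pullback_unitPt_cotangentSheaf_iso_free_of_card {ι : Type u} [Fintype ι]
    (hι : Fintype.card ι = A.dim) :
    Nonempty ((Scheme.Modules.pullback (unitPt A)).obj (cotangentSheaf A.X) ≅ SheafOfModules.free ι) := by
  haveI := A.smoothOfRelativeDimension_dim
  obtain ⟨V, hV, heV, ι', hfin, hcard, ⟨b⟩⟩ :=
    exists_basis_sections_cotangentSheaf A.X A.dim (origin A)
  haveI := Fintype.ofFinite ι'
  have eι : ι' ≃ ι := Fintype.equivOfCardEq (by rw [← Nat.card_eq_fintype_card, hcard, hι])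
  -- the frame `𝒪^ι ≅ Ω¹.over V` from the basis of `Γ(V, Ω¹)`
  obtain ⟨e₁⟩ := nonempty_free_iso_over_of_basis (cotangentSheaf A.X)
    (isAffineLocalizing_cotangentSheaf A.X) hV (b.reindex eι)
  -- frames pull back: `𝒪^ι ≅ (e^*Ω¹).over (e⁻¹V)`
  obtain ⟨e₂⟩ : Nonempty (SheafOfModules.free ι ≅
      ((Scheme.Modules.pullback (unitPt A)).obj (cotangentSheaf A.X)).over ((unitPt A) ⁻¹ᵁ V)) := by
    obtain ⟨e'⟩ := nonempty_restrictIso_of_overIso e₁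
    obtain ⟨f₁⟩ := nonempty_pullbackFreeIso ((unitPt A) ∣_ V) ι
    obtain ⟨f₂⟩ := nonempty_restrictPullbackIso (unitPt A) V (cotangentSheaf A.X)
    exact nonempty_overIso_of_restrictIso
      (f₁.symm ≪≫ (Scheme.Modules.pullback ((unitPt A) ∣_ V)).mapIso e' ≪≫ f₂.symm)
  exact nonempty_iso_free_of_overIso_of_eq_top _ (unitPt_preimage_eq_top A heV) e₂

/-- **`π^* e^* Ω¹_{A/K} ≅ 𝒪_A^ι` for any index type with `dim A` elements** — the right-hand side of
BLR's `Ω¹_{G/S} ≅ π^*e^*Ω¹_{G/S}` made explicit for an abelian variety (`π^*𝒪^ι ≅ 𝒪^ι`).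
[cite: BoschLutkebohmertRaynaud1990, §4.2 Prop. 2] -/
theorem nonempty_pullback_hom_pullback_unitPt_cotangentSheaf_iso_free_of_card {ι : Type u} [Fintype ι]
    (hι : Fintype.card ι = A.dim) :
    Nonempty ((Scheme.Modules.pullback A.X.hom).obj
      ((Scheme.Modules.pullback (unitPt A)).obj (cotangentSheaf A.X)) ≅ SheafOfModules.free ι) := by
  obtain ⟨e⟩ := nonempty_pullback_unitPt_cotangentSheaf_iso_free_of_card A hι
  obtain ⟨f⟩ := nonempty_pullbackFreeIso A.X.hom ι
  exact ⟨(Scheme.Modules.pullback A.X.hom).mapIso e ≪≫ f⟩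

end AbelianVariety

/-! ### Universe `0`: the `Fin (dim A)` forms (the currency of `Mumford1970_cotangentSheaf_abelianVariety_free`) -/

namespace AbelianVariety

variable {K : Type} [Field K] (A : AbelianVariety K)

/-- **`e^*Ω¹_{A/K} ≅ 𝒪_{Spec K}^{dim A}`**: the cotangent sheaf of an abelian variety, pulled back to the
origin, is free of rank `dim A`. [cite: BoschLutkebohmertRaynaud1990, §4.2 Prop. 2] [cite: StacksProject, Tag 02G1] -/
theorem nonempty_pullback_unitPt_cotangentSheaf_iso_free :
    Nonempty ((Scheme.Modules.pullback (unitPt A)).obj (cotangentSheaf A.X) ≅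
      SheafOfModules.free (Fin A.dim)) :=
  nonempty_pullback_unitPt_cotangentSheaf_iso_free_of_card A (Fintype.card_fin A.dim)

/-- **`π^* e^* Ω¹_{A/K} ≅ 𝒪_A^{dim A}`** — consumed verbatim by the BLR assembly
`Ω¹_{A/K} ≅ π^* e^* Ω¹_{A/K}` (`Theorems/VHCAbelianSchemesRoadCotangentSheafFreeHolds`).
[cite: BoschLutkebohmertRaynaud1990, §4.2 Prop. 2] -/
theorem nonempty_pullback_hom_pullback_unitPt_cotangentSheaf_iso_free :
    Nonempty ((Scheme.Modules.pullback A.X.hom).obj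
      ((Scheme.Modules.pullback (unitPt A)).obj (cotangentSheaf A.X)) ≅ SheafOfModules.free (Fin A.dim)) :=
  nonempty_pullback_hom_pullback_unitPt_cotangentSheaf_iso_free_of_card A (Fintype.card_fin A.dim)

end AbelianVariety

end Literature.AlgebraicGeometry.Motives

end
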